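import Literature.AlgebraicGeometry.Motives.AbelianVarietyBaseChange
import Literature.AlgebraicGeometry.Motives.SupersingularAbelianVariety
import Literature.NumberTheory.DiophantineGeometry.AVIsogenyTate
import Mathlib.RingTheory.SimpleRing.Congr
import Mathlib.Algebra.Central.Basic
import HarnessLib

/-!
# Base change along an isomorphism of fields is an equivalence

For fields `K`, `L` carrying **mutually inverse** algebra structures — `algebraMap K L` and
`algebraMap L K` are inverse isomorphisms of fields (the situation of an algebraically closed
field `k` and its algebraic closure `k̄ = AlgebraicClosure k`, `k ≅ k̄`) — base change of
`K`-schemes to `L` (`bcFunctor K L = Over.pullback (Spec L → Spec K)`) and of `L`-schemes to `K`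
are mutually inverse equivalences (`baseChangeEquivOfInverse`; Mathlib `Over.pullbackComp`,
`Over.pullbackId`: base change along `K → L → K = id` is the identity). Consequences for abelian
varieties (`Motives/AbelianVarietyBaseChange`): `f ↦ f_L` is bijective on homomorphisms
(`Hom.baseChange_bijective_of_inverse`; Mathlib `Functor.Full.mapGrp`, `Faithful.mapGrp`), in
particular **`End A ≃+* End A_L`** (`endRingEquivOfInverse`) and `End⁰(A) ≃ₐ[ℚ] End⁰(A_L)`
(`endAlgebraEquivOfInverse`), so that the ring-theoretic properties of `End⁰` (finite
dimension, simplicity, centrality, dimension) pass between `A` and `A_L`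
(`…_endAlgebra_baseChange_iff`-type lemmas). This is the transport used to move a supersingular
elliptic curve over `k̄` back to the algebraically closed base field `k` in
`Motives/SupersingularAbelianVariety`.

Everything is a theorem or a definition with a body built from Mathlib's `Over.pullback` API; no
named facts.

## References

* U. Görtz, T. Wedhorn, *Algebraic Geometry I* (2020), (4.7) and Remark 16.54 (base change of
  schemes and of group schemes). [GortzWedhorn2020]
* D. Mumford, *Abelian Varieties* (1970), §19 ("The structure of `End⁰(X)`"). [MumfordAV1970]
-/

noncomputable section

universe u

open CategoryTheory AlgebraicGeometry MonoidalCategory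
open scoped TensorProduct

namespace Literature.AlgebraicGeometry.Motives

namespace AbelianVariety

variable (K : Type u) [Field K] (L : Type u) [Field L] [Algebra K L] [Algebra L K]

/-! ## The equivalence `Sch/K ≌ Sch/L` -/

/-- If `algebraMap L K ∘ algebraMap K L = id`, then `Spec K → Spec L → Spec K` is the identity.
[folklore] -/
theorem bcSpec_comp_bcSpec (hKL : ∀ x : K, algebraMap L K (algebraMap K L x) = x) :
    bcSpec L K ≫ bcSpec K L = 𝟙 (Spec (.of K)) := by
  rw [← Spec.map_comp, ← CommRingCat.ofHom_comp,
    show (algebraMap L K).comp (algebraMap K L) = RingHom.id K from RingHom.ext hKL,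
    CommRingCat.ofHom_id, Spec.map_id]

/-- `Over.pullback` only depends on the morphism (the `HasPullbacksAlong` instances are
propositions). [folklore] -/
theorem overPullback_congr {C : Type*} [Category C] {X Y : C} {f g : X ⟶ Y} (h : f = g)
    [Limits.HasPullbacksAlong f] [Limits.HasPullbacksAlong g] :
    Over.pullback f = Over.pullback g := by
  subst h
  rfl

/-- **Base change along inverse isomorphisms of fields is an equivalence of categories**
`Sch/K ≌ Sch/L`, with functor `bcFunctor K L = (· ×_K L)` and inverse `bcFunctor L K`
(Mathlib `Over.pullbackComp`, `Over.pullbackId`). [folklore] -/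
def baseChangeEquivOfInverse (hKL : ∀ x : K, algebraMap L K (algebraMap K L x) = x)
    (hLK : ∀ y : L, algebraMap K L (algebraMap L K y) = y) : SchemeOver K ≌ SchemeOver L :=
  CategoryTheory.Equivalence.mk (bcFunctor K L) (bcFunctor L K)
    (Over.pullbackId.symm ≪≫ eqToIso (overPullback_congr (bcSpec_comp_bcSpec K L hKL).symm) ≪≫
      Over.pullbackComp (bcSpec L K) (bcSpec K L))
    ((Over.pullbackComp (bcSpec K L) (bcSpec L K)).symm ≪≫
      eqToIso (overPullback_congr (bcSpec_comp_bcSpec L K hLK)) ≪≫ Over.pullbackId)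

/-- The functor of `baseChangeEquivOfInverse` is `bcFunctor K L`. [folklore] -/
@[simp]
theorem baseChangeEquivOfInverse_functor (hKL : ∀ x : K, algebraMap L K (algebraMap K L x) = x)
    (hLK : ∀ y : L, algebraMap K L (algebraMap L K y) = y) :
    (baseChangeEquivOfInverse K L hKL hLK).functor = bcFunctor K L := rfl

/-- Under inverse algebra structures, `bcFunctor K L` is an equivalence. [folklore] -/
theorem isEquivalence_bcFunctor (hKL : ∀ x : K, algebraMap L K (algebraMap K L x) = x)
    (hLK : ∀ y : L, algebraMap K L (algebraMap L K y) = y) : (bcFunctor K L).IsEquivalence :=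
  (baseChangeEquivOfInverse K L hKL hLK).isEquivalence_functor

/-! ## Homomorphisms of abelian varieties -/

variable {K}

/-- **`f ↦ f_L` is bijective** for base change along inverse isomorphisms of fields: the
functor `Over.pullback` is then full and faithful, hence so is `Functor.mapGrp` (Mathlib
`Functor.Full.mapGrp`, `Functor.Faithful.mapGrp`). [folklore] -/
theorem Hom.baseChange_bijective_of_inverse (hKL : ∀ x : K, algebraMap L K (algebraMap K L x) = x)
    (hLK : ∀ y : L, algebraMap K L (algebraMap L K y) = y) (A B : AbelianVariety K) :
    Function.Bijective (Hom.baseChange L : (A ⟶ B) → (A.baseChange L ⟶ B.baseChange L)) := by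
  haveI := isEquivalence_bcFunctor K L hKL hLK
  haveI : (bcFunctor K L).mapGrp.Full := Functor.Full.mapGrp
  haveI : (bcFunctor K L).mapGrp.Faithful := Functor.Faithful.mapGrp
  constructor
  · intro f g h
    have h' : (bcFunctor K L).map f.hom.hom.hom = (bcFunctor K L).map g.hom.hom.hom := by
      rw [← Hom.baseChange_hom_hom_hom, ← Hom.baseChange_hom_hom_hom, h]
    exact hom_ext _ _ ((bcFunctor K L).map_injective h')
  · intro g
    let g' : (bcFunctor K L).mapGrp.obj A.toGrp ⟶ (bcFunctor K L).mapGrp.obj B.toGrp := g.hom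
    refine ⟨InducedCategory.homMk ((bcFunctor K L).mapGrp.preimage g'), ?_⟩
    apply hom_ext
    have h := (bcFunctor K L).mapGrp.map_preimage g'
    exact congrArg (fun φ ↦ φ.hom.hom) h

/-- **`End A ≃+* End A_L`** for base change along inverse isomorphisms of fields: the ring
homomorphism `f ↦ f_L` (`Hom.baseChange_id`, `_comp`, `_add`) is bijective
(`Hom.baseChange_bijective_of_inverse`). [folklore] -/
def endRingEquivOfInverse (hKL : ∀ x : K, algebraMap L K (algebraMap K L x) = x)
    (hLK : ∀ y : L, algebraMap K L (algebraMap L K y) = y) (A : AbelianVariety K) :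
    End A ≃+* End (A.baseChange L) :=
  RingEquiv.ofBijective
    ({ toFun := fun f ↦ Hom.baseChange L f
       map_one' := Hom.baseChange_id L A
       map_mul' := fun f g ↦ Hom.baseChange_comp L g f
       map_zero' := (baseChangeFunctor K L).map_zero A A
       map_add' := fun f g ↦ Hom.baseChange_add L f g } : End A →+* End (A.baseChange L))
    (Hom.baseChange_bijective_of_inverse L hKL hLK A A)

/-- `endRingEquivOfInverse` is `f ↦ f_L`. [folklore] -/
@[simp]
theorem endRingEquivOfInverse_apply (hKL : ∀ x : K, algebraMap L K (algebraMap K L x) = x)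
    (hLK : ∀ y : L, algebraMap K L (algebraMap L K y) = y) (A : AbelianVariety K) (f : End A) :
    endRingEquivOfInverse L hKL hLK A f = Hom.baseChange L f := rfl

/-! ## Transport of the endomorphism algebra along a ring isomorphism of `End` -/

section EndAlgebra

variable {L}
variable {K' : Type u} [Field K'] {A : AbelianVariety K} {B : AbelianVariety K'}

/-- In `End⁰ = ℚ ⊗_ℤ End`, `q ⊗ f = q · (1 ⊗ f)`. [folklore] -/
private theorem tmul_eq_algebraMap_mul_of' (X : AbelianVariety K) (q : ℚ) (f : End X) :
    (q ⊗ₜ[ℤ] f : X.endAlgebra) = algebraMap ℚ X.endAlgebra q * endAlgebra.of X f := by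
  rw [Algebra.algebraMap_eq_smul_one, smul_mul_assoc, one_mul]
  show q ⊗ₜ[ℤ] f = q • ((1 : ℚ) ⊗ₜ[ℤ] f)
  rw [TensorProduct.smul_tmul', smul_eq_mul, mul_one]

/-- `ℤ`, `ℚ` and `End⁰(X)` form a scalar tower (the `ℤ`-action on the `ℚ`-algebra `End⁰(X)` is
the integer multiple). [folklore] -/
theorem endAlgebra.isScalarTower_int_rat (X : AbelianVariety K) : IsScalarTower ℤ ℚ X.endAlgebra :=
  ⟨fun n q x ↦ by
    simp only [zsmul_eq_mul]
    rw [mul_smul, Algebra.smul_def (n : ℚ), map_intCast]⟩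

attribute [local instance] endAlgebra.isScalarTower_int_rat

/-- The `ℚ`-algebra homomorphism `End⁰(A) → End⁰(B)`, `q ⊗ f ↦ q ⊗ e f`, induced by a ring
homomorphism `e : End A → End B` (Mathlib `Algebra.TensorProduct.lift`). [folklore] -/
def endAlgebra.mapRingHom (e : End A →+* End B) : A.endAlgebra →ₐ[ℚ] B.endAlgebra :=
  Algebra.TensorProduct.lift (Algebra.ofId ℚ B.endAlgebra)
    { (endAlgebra.of B).comp e with
      commutes' := fun n ↦ RingHom.congr_fun (RingHom.ext_int
        (((endAlgebra.of B).comp e).comp (algebraMap ℤ (End A))) (algebraMap ℤ B.endAlgebra)) n }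
    fun q _ ↦ Algebra.commute_algebraMap_left q _

/-- `endAlgebra.mapRingHom e (q ⊗ f) = q ⊗ e f`. [folklore] -/
theorem endAlgebra.mapRingHom_tmul (e : End A →+* End B) (q : ℚ) (f : End A) :
    endAlgebra.mapRingHom e (q ⊗ₜ[ℤ] f) = (q ⊗ₜ[ℤ] e f : B.endAlgebra) := by
  change Algebra.TensorProduct.lift _ _ _ (q ⊗ₜ[ℤ] f) = _
  rw [Algebra.TensorProduct.lift_tmul, tmul_eq_algebraMap_mul_of' B q (e f)]
  rfl

/-- **`End⁰(A) ≃ₐ[ℚ] End⁰(B)` from a ring isomorphism `End A ≃+* End B`** (functoriality of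
`ℚ ⊗_ℤ -`; Mumford §19, "The structure of `End⁰(X)`"). [folklore] -/
def endAlgebra.congrRingEquiv (e : End A ≃+* End B) : A.endAlgebra ≃ₐ[ℚ] B.endAlgebra :=
  AlgEquiv.ofAlgHom (endAlgebra.mapRingHom e.toRingHom) (endAlgebra.mapRingHom e.symm.toRingHom)
    (by
      refine AlgHom.ext fun x ↦ ?_
      induction x using TensorProduct.induction_on with
      | zero =>
        show endAlgebra.mapRingHom e.toRingHom
          (endAlgebra.mapRingHom e.symm.toRingHom (0 : B.endAlgebra)) = 0
        rw [map_zero, map_zero]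
      | tmul q f =>
        rw [AlgHom.comp_apply, endAlgebra.mapRingHom_tmul, endAlgebra.mapRingHom_tmul]
        change (q ⊗ₜ[ℤ] e (e.symm f) : B.endAlgebra) = q ⊗ₜ[ℤ] f
        rw [e.apply_symm_apply]
      | add x y hx hy =>
        exact (map_add _ x y).trans ((congrArg₂ (· + ·) hx hy).trans (map_add _ x y).symm))
    (by
      refine AlgHom.ext fun x ↦ ?_
      induction x using TensorProduct.induction_on with
      | zero =>
        show endAlgebra.mapRingHom e.symm.toRingHom
          (endAlgebra.mapRingHom e.toRingHom (0 : A.endAlgebra)) = 0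
        rw [map_zero, map_zero]
      | tmul q f =>
        rw [AlgHom.comp_apply, endAlgebra.mapRingHom_tmul, endAlgebra.mapRingHom_tmul]
        change (q ⊗ₜ[ℤ] e.symm (e f) : A.endAlgebra) = q ⊗ₜ[ℤ] f
        rw [e.symm_apply_apply]
      | add x y hx hy =>
        exact (map_add _ x y).trans ((congrArg₂ (· + ·) hx hy).trans (map_add _ x y).symm))

/-- **The `End⁰` data of Deuring/Albert type pass along a ring isomorphism of `End`**: if
`End A ≃+* End B` then `End⁰(A)` finite-dimensional, simple, central of `ℚ`-dimension `d`
implies the same for `End⁰(B)`. [folklore] -/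
theorem endAlgebra.transfer (e : End A ≃+* End B) (hfd : A.finiteDimensional_endAlgebra)
    (hs : IsSimpleRing A.endAlgebra) (hc : Algebra.IsCentral ℚ A.endAlgebra) {d : ℕ}
    (hd : Module.finrank ℚ A.endAlgebra = d) :
    B.finiteDimensional_endAlgebra ∧ IsSimpleRing B.endAlgebra ∧ Algebra.IsCentral ℚ B.endAlgebra ∧
      Module.finrank ℚ B.endAlgebra = d := by
  let φ := endAlgebra.congrRingEquiv e
  haveI : Module.Finite ℚ A.endAlgebra := hfd
  haveI := hc
  refine ⟨?_, IsSimpleRing.of_ringEquiv φ.toRingEquiv hs, Algebra.IsCentral.of_algEquiv ℚ _ _ φ, ?_⟩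
  · exact Module.Finite.equiv φ.toLinearEquiv
  · rw [← hd]
    exact φ.toLinearEquiv.finrank_eq.symm

end EndAlgebra

/-! ## The underlying schemes: `(A_L)_K ≅ A` and `(E^{g+1})_K ≅ (E_K)^{g+1}` -/

section Schemes

/-- **`(A_L)_K ≅ A`** as `K`-schemes, for base change along inverse isomorphisms of fields
(the unit of `baseChangeEquivOfInverse`). [folklore] -/
def baseChangeBaseChangeXIso (hKL : ∀ x : K, algebraMap L K (algebraMap K L x) = x)
    (hLK : ∀ y : L, algebraMap K L (algebraMap L K y) = y) (A : AbelianVariety K) :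
    ((A.baseChange L).baseChange K).X ≅ A.X :=
  ((baseChangeEquivOfInverse K L hKL hLK).unitIso.app A.X).symm

variable (K) {L} in
/-- **`(E^{g+1})_K ≅ (E_K)^{g+1}`** as `K`-schemes: base change is monoidal for the cartesian
structures (Mathlib `Functor.Monoidal.μIso` for `Over.pullback`), by induction on `g`.
[folklore] -/
def powSuccBaseChangeXIso (E : AbelianVariety L) :
    (g : ℕ) → ((E.powSucc g).baseChange K).X ≅ ((E.baseChange K).powSucc g).X
  | 0 => Iso.refl _
  | g + 1 => (Functor.Monoidal.μIso (bcFunctor L K) (E.powSucc g).X E.X).symm ≪≫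
      (powSuccBaseChangeXIso E g ⊗ᵢ Iso.refl _)

end Schemes

end AbelianVariety

end Literature.AlgebraicGeometry.Motives

end
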